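import Summits.BirchSwinnertonDyer.BirchSwinnertonDyer.Theorems.PrintCf2DisegniPairTwoQuotientLawChi8
import Summits.BirchSwinnertonDyer.BirchSwinnertonDyer.Theorems.PrintCf2DisegniPairTwoChiLineFactorisationOdd
import Summits.BirchSwinnertonDyer.BirchSwinnertonDyer.Theorems.PrintCf2DisegniPairTwoChiLineLeadingCoeffMinusEight
import HarnessLib

/-!
# Road (C) `disegni-pair-two` on crux stmt-BirchSwinnertonDyer-20368 — the QUOTIENT LAW INSTANTIATED on the two
# ODD lines (`d* = −1`: `χ₋₄∘N`, minus branch at `T = 0`; `d* = −2`: `χ₋₈∘N`, minus branch at `T = −2`), BY NAME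

Cell `bsd-print-cf2` (`run/shared/lean/pub/bsd-print-cf2/`), width seat `bsd-line-cf2-p1-w8` g22; sequel of
`PrintCf2DisegniPairTwoQuotientLawChi8.lean` (the even line `d* = 2`). `--supports stmt-BirchSwinnertonDyer-20368`
(helper). THEOREMS ONLY (no `def`, no named fact, no `sorry`); conditional on every displayed hypothesis (the road's
PRINT stub `ChiLineGrossZagierClauses`, PIN, invariance, modularity, newform data). BSD is not proved by any of this;
no summit statement is claimed; 20368 is not closed here.

* ★★ `quotient_law_chi4` (`d* = −1`, member `V^{(−1)}`, `t² = −1`): the quotient law with the tower seam + PIN, the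
  archimedean evaluation, -w8 g21's `coeff_one_chi4Line_eq_of_constantCoeff_eq_zero`
  (`[T¹]G = ι⁻¹(−u·Car·Ω⁻_f·Ω⁻_{f′})·[T¹]L₂⁻(f,ω)·L₂⁻(f′,ω,0)`) and `Z° ≠ 0` plugged by name:
  `ι⁻¹(L′(W,1)·L(W′,1)·Z°)·h₂ = −σ₀·log₂5·ι⁻¹(ĥ(P)·u·Ω⁻_f·Ω⁻_{f′})·[T¹]L₂⁻(f,ω)·L₂⁻(f′,ω,0)`.
* ★★ `quotient_law_chi8'` (`d* = −2`, member `V^{(−2)}`, `t² = −2`): the same with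
  `coeff_one_chi8'Line_eq_of_hasSum_zero` (branch point `−2`; the sign of the constant is carried as
  `c₀ = −u·Ω⁻_f·Ω⁻_{f′}`).

References: D. Disegni, Compos. Math. 153 (2017) Thm. A, (1.1.3), Thm. B [Disegni2017]; B. Perrin-Riou, Invent. Math.
89 (1987) §1 [PerrinRiou1987]; B. Mazur, J. Tate, J. Teitelbaum, Invent. Math. 84 (1986) §I.14
[MazurTateTeitelbaum1986Invent].
-/

set_option autoImplicit false
set_option linter.dupNamespace false

noncomputable section

open scoped Classical MatrixGroups ModularForm NumberField

open CongruenceSubgroup NumberField IsDedekindDomain WeierstrassCurve WeierstrassCurve.Affine.Point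
  Literature.NumberTheory.EllipticCurves Literature.NumberTheory.EllipticCurves.ModularForms
  Literature.NumberTheory.EllipticCurves.Disegni2017 Literature.NumberTheory.GaloisRepresentations
  Summit.BirchSwinnertonDyer.Rank1Residual.AdditivePotMult

namespace Summit.BirchSwinnertonDyer.BirchSwinnertonDyer.Theorems.PrintCf2.DisegniPairTwo

section Odd

variable (ι : PadicAlgCl 2 ≃+* ℂ) (K : Type) [Field K] [NumberField K] [IsGalois ℚ K]

/-- ★★ **THE QUOTIENT LAW on the `χ₋₄∘N` (= ω∘N)-line, by name** (module docstring). Frame: `K = E′` quadratic with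
`(2, d_K) = 1`, `2` split (`𝔭, 𝔭′`), Kronecker character `κ`; `V`, `V′` globally minimal, good ORDINARY at `2` with the
same `a₂`, newforms `f`, `f′` (`a_n(f′) = κ(n)a_n(f)`), `2 ∤ N`; `L₂⁻(f,ω,0) = 0` (`h0`); the member `W` and its
companion `W′` with newforms `g = f⊗χ₈`, `g′ = f′⊗χ₈`, `L(W,1) = 0`, `L′(W,1) ≠ 0`, `L(W′,1) ≠ 0`; the tower
`K ⊂ H = K(t)`, `t² = -1`, with `τ` (fixing `K`, `τt = −t`) in `G` of sign `−1` and `c ∈ Aut(K/ℚ)`, `cu = −u`,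
`u² = e`; `V^{(2)}(ℚ) = ℤP + torsion`, `V^{(2)(e)}(ℚ)` torsion; `DH` `G`-invariant with PIN `⟨P′,P′⟩_{DH} = h₂`;
Disegni's conjoined clauses `hGZ` at `a = ι(α)`, `χ_H = χ₈∘N`. Then
`ι⁻¹(L′(W,1)·L(W′,1)·Z°)·h₂ = −σ₀·log₂5·ι⁻¹(ĥ(P)·u·Ω⁺_f·Ω⁺_{f′})·L₂′(f,−2)·L₂(f′,−2)` for a sign `σ₀`.
[cite: Disegni2017, Theorem A, (1.1.3), Theorem B (arXiv v3 PDF pp. 4–8)] [cite: PerrinRiou1987, §1]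
[cite: MazurTateTeitelbaum1986Invent, §I.14 (14.3)] -/
theorem quotient_law_chi4 (h2 : Module.finrank ℚ K = 2)
    (hsplit : ((Ideal.span {(2 : ℤ)}).primesOver (𝓞 K)).ncard = 2)
    (𝔭 𝔭' : HeightOneSpectrum (𝓞 K)) (h𝔭 : ((2 : ℕ) : 𝓞 K) ∈ 𝔭.asIdeal)
    (h𝔭' : ((2 : ℕ) : 𝓞 K) ∈ 𝔭'.asIdeal)
    (κ : DirichletCharacter ℂ (NumberField.discr K).natAbs)
    (hκ : ∀ ℓ : ℕ, ℓ.Prime → ℓ ≠ 2 → κ ℓ = (jacobiSym (NumberField.discr K) ℓ : ℂ))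
    (hκ2 : κ 2 = if NumberField.discr K % 8 = 1 then 1
        else if NumberField.discr K % 8 = 5 then -1 else 0)
    (hd : Nat.Coprime 2 (NumberField.discr K).natAbs)
    -- the good pair
    (V V' : WeierstrassCurve ℚ) [V.IsElliptic] [V.IsGloballyMinimal] [V'.IsElliptic] [V'.IsGloballyMinimal]
    (hordV : IsOrdinaryAt V 2) (hordV' : IsOrdinaryAt V' 2) (hap : V'.frobeniusTrace 2 = V.frobeniusTrace 2)
    {N N' : ℕ} [NeZero N] [NeZero N'] {f : CuspForm (Gamma0 N) 2}
    {f' : CuspForm (Gamma0 N') 2} (hfV : IsNewformOf V f) (hfV' : IsNewformOf V' f')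
    (hV' : ∀ n : ℕ, cuspCoeff f' n = κ (n : ZMod _) * cuspCoeff f n)
    (h0 : PowerSeries.constantCoeff (padicLFunctionMinusBranch f (unitRoot V 2 : ℚ_[2]) 1) = 0)
    -- the member and its companion (archimedean side)
    (hmod : hasEntireLFunction_rat) {M M' : ℕ} [NeZero M] [NeZero M']
    {g : CuspForm (Gamma0 M) 2} {g' : CuspForm (Gamma0 M') 2}
    (W W' : WeierstrassCurve ℚ) [W.IsElliptic] [W'.IsElliptic]
    (hg : IsNewformOf W g) (hg' : IsNewformOf W' g')
    (hgε : ∀ m : ℕ, cuspCoeff g m = (ZMod.χ₄.ringHomComp (Int.castRingHom ℂ)) m * cuspCoeff f m)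
    (hg'ε : ∀ m : ℕ, cuspCoeff g' m = (ZMod.χ₄.ringHomComp (Int.castRingHom ℂ)) m * cuspCoeff f' m)
    (hW1 : W.entireLFunction 1 = 0) (hL : deriv W.entireLFunction 1 ≠ 0) (hL' : W'.entireLFunction 1 ≠ 0)
    -- the tower frame and the sign character
    {H : Type} [Field H] [NumberField H] [Algebra K H] (hKH : Module.finrank K H = 2) {t : H}
    (htK : t ∉ Set.range (algebraMap K H)) (ht2 : t ^ 2 = algebraMap ℚ H (-1))
    (G : Subgroup (H ≃ₐ[ℚ] H)) (χ : G →* ℂˣ) (s : G → ℤ) (hs : ∀ σ, ((χ σ : ℂˣ) : ℂ) = (s σ : ℂ))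
    (τ : H ≃ₐ[ℚ] H) (hτG : τ ∈ G) (hsτ : s ⟨τ, hτG⟩ = -1)
    (hτK : ∀ a : K, τ (algebraMap K H a) = algebraMap K H a) (hτt : τ t = -t)
    {u : K} {e : ℚ} (hu : u ∉ Set.range (algebraMap ℚ K)) (hue : u ^ 2 = algebraMap ℚ K e)
    (c : K ≃ₐ[ℚ] K) (hcu : c u = -u)
    -- the member's Mordell–Weil data
    [(V.quadraticTwist (-1)).IsElliptic] {P : (V.quadraticTwist (-1)).toAffine.Point}
    (hgen : ∀ R : (V.quadraticTwist (-1)).toAffine.Point,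
      ∃ (k : ℤ) (T : (V.quadraticTwist (-1)).toAffine.Point), IsOfFinAddOrder T ∧ R = k • P + T)
    (htors : ∀ Q : ((V.quadraticTwist (-1)).quadraticTwist e).toAffine.Point, IsOfFinAddOrder Q)
    -- Disegni's datum: invariance, PIN, and the conjoined clauses (PRINT stub of the road)
    (DH : PAdicHeightDataK V 2 H)
    (hDH : ∀ (σ : G) (a b : (V.baseChange H).toAffine.Point),
      DH.pairing (pointGalHom V H σ.1 a) (pointGalHom V H σ.1 b) = DH.pairing a b)
    {h₂ : ℚ_[2]}
    (hpin : DH.pairing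
      (twistPointEquivOver V (not_mem_range_rat_of_not_mem_range htK) ht2
        (QuadraticDescent.incl H (V.quadraticTwist (-1)) P))
      (twistPointEquivOver V (not_mem_range_rat_of_not_mem_range htK) ht2
        (QuadraticDescent.incl H (V.quadraticTwist (-1)) P)) = h₂)
    (hGZ : ChiLineGrossZagierClauses ι K V H f (ι (((unitRoot V 2 : ℚ_[2]) : PadicAlgCl 2)))
      (baseChangeDirichlet K (ZMod.χ₄.ringHomComp (Int.castRingHom ℂ))) 𝔭 𝔭' G χ DH) :
    ∃ σ₀ : ℤˣ,
      ((ι.symm ((deriv W.entireLFunction 1 * W'.entireLFunction 1) *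
          zCirc (p := 2) (ι (((unitRoot V 2 : ℚ_[2]) : PadicAlgCl 2))) N
            (baseChangeDirichlet K (ZMod.χ₄.ringHomComp (Int.castRingHom ℂ))) 𝔭 𝔭') : PadicAlgCl 2) : ℂ_[2]) *
        algebraMap ℚ_[2] ℂ_[2] h₂ =
      -((σ₀ : ℤ) : ℂ_[2]) * algebraMap ℚ_[2] ℂ_[2] (padicLog 2 (cyclotomicGenerator 2)) *
        ((ι.symm ((canonicalHeight P : ℂ) *
            ((splitLocalConstant 2 : ℂ) * (minusPeriod f : ℂ) * (minusPeriod f' : ℂ))) : PadicAlgCl 2) : ℂ_[2]) *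
        (algebraMap ℚ_[2] ℂ_[2] (PowerSeries.coeff 1 (padicLFunctionMinusBranch f (unitRoot V 2 : ℚ_[2]) 1)) *
          algebraMap ℚ_[2] ℂ_[2]
            (PowerSeries.constantCoeff (padicLFunctionMinusBranch f' (unitRoot V 2 : ℚ_[2]) 1))) := by
  haveI : NeZero (2 ^ 2) := ⟨by norm_num⟩
  -- (1) the seam, with the PIN substituted
  have hseam : ∀ y₁ y₂ : (V.baseChange H).toAffine.Point, ∃ r : ℚ,
      chiHeightPairing V H G χ y₁ y₂ =
        (((r : ℝ) * (Module.finrank ℚ H : ℝ) * canonicalHeight P : ℝ) : ℂ) ∧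
      chiPAdicPairing ι V H DH G χ y₁ y₂ = algebraMap ℚ_[2] ℂ_[2] ((r : ℚ_[2]) * h₂) := by
    intro y₁ y₂
    obtain ⟨r, hNT, hPA⟩ := exists_rat_chiPairings_eq_tower V G χ s hKH htK ht2 hs τ hτG hsτ hτK hτt h2 hu
      hue c hcu hgen htors y₁ y₂
    exact ⟨r, hNT, by rw [hPA 2 ι DH hDH, hpin]⟩
  -- (2) the archimedean evaluation `Λ′ = L′(W,1)·L(W′,1)`
  have harch : ∀ (Car : ℝ) (y₁ y₂ : (V.baseChange H).toAffine.Point) (q : ℂ),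
      ChiArchRatioClause K V H f (baseChangeDirichlet K (ZMod.χ₄.ringHomComp (Int.castRingHom ℂ))) Car G χ
        y₁ y₂ q →
        ((Module.finrank ℚ H : ℂ))⁻¹ * chiHeightPairing V H G χ y₁ y₂ =
          q / 2 * (Car : ℂ) * (deriv W.entireLFunction 1 * W'.entireLFunction 1) :=
    fun Car y₁ y₂ q hA =>
      chiArchRatioClause_apply_of_entireLFunction_one_eq_zero K hmod h2 κ hκ hκ2 hd hfV.1 hV' (n := 2)
        (ε := (ZMod.χ₄.ringHomComp (Int.castRingHom ℂ) : DirichletCharacter ℂ (2 ^ 2)))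
        chi4_isPrimitive W W' hg hg' hgε hg'ε hW1 hA
  -- (3) the factorisation of the first coefficient
  have hfact : ∀ (Car : ℝ) (Gχ : PowerSeries ℂ_[2]),
      ChiLineInterpolation ι K f (ι (((unitRoot V 2 : ℚ_[2]) : PadicAlgCl 2)))
        (baseChangeDirichlet K (ZMod.χ₄.ringHomComp (Int.castRingHom ℂ))) 𝔭 𝔭' Car Gχ →
      PowerSeries.coeff 1 Gχ =
        -((ι.symm (((splitLocalConstant 2 : ℂ) * (minusPeriod f : ℂ) * (minusPeriod f' : ℂ)) * (Car : ℂ)) :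
            PadicAlgCl 2) : ℂ_[2]) *
          (algebraMap ℚ_[2] ℂ_[2] (PowerSeries.coeff 1 (padicLFunctionMinusBranch f (unitRoot V 2 : ℚ_[2]) 1)) *
            algebraMap ℚ_[2] ℂ_[2]
              (PowerSeries.constantCoeff (padicLFunctionMinusBranch f' (unitRoot V 2 : ℚ_[2]) 1))) := by
    intro Car Gχ hInt
    have hψ : ∀ z : ℂ, ((ι.symm z : PadicAlgCl 2) : ℂ_[2]) =
        ((algebraMap (PadicAlgCl 2) ℂ_[2]).comp ι.symm.toRingHom) z := fun _ => rfl
    rw [coeff_one_chi4Line_eq_of_constantCoeff_eq_zero ι K h2 hsplit 𝔭 𝔭' h𝔭 h𝔭' κ hκ hκ2 hd V V' hordV hordV'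
      hap hfV hfV' hV' hInt h0, hψ, hψ,
      show -(splitLocalConstant 2 : ℂ) * (Car : ℂ) * (minusPeriod f : ℂ) * (minusPeriod f' : ℂ) =
        -(((splitLocalConstant 2 : ℂ) * (minusPeriod f : ℂ) * (minusPeriod f' : ℂ)) * (Car : ℂ)) by ring, map_neg]
    ring
  -- (4) `Z° ≠ 0` (the character is primitive, `a = ι(α) ≠ 0`)
  have ha : ι (((unitRoot V 2 : ℚ_[2]) : PadicAlgCl 2)) ≠ 0 := by
    have hα : (unitRoot V 2 : ℚ_[2]) ≠ 0 := by
      rw [← norm_pos_iff, norm_unitRoot_holds V 2 hordV]; exact one_pos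
    rw [map_ne_zero]
    exact (map_ne_zero_iff _ (algebraMap ℚ_[2] (PadicAlgCl 2)).injective).mpr hα
  have hZ := zCirc_baseChangeDirichlet_ne_zero (p := 2) K h2 hsplit (n := 2) (by norm_num)
    (θ := (ZMod.χ₄.ringHomComp (Int.castRingHom ℂ) : DirichletCharacter ℂ (2 ^ 2)))
    chi4_isPrimitive ha N 𝔭 𝔭' h𝔭 h𝔭'
  exact quotient_law_of_clauses ι hGZ hseam (mul_ne_zero hL hL') harch hfact hZ


/-- ★★ **THE QUOTIENT LAW on the `χ₋₈∘N` (= χ₈ω∘N)-line, by name** (module docstring). Frame: `K = E′` quadratic with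
`(2, d_K) = 1`, `2` split (`𝔭, 𝔭′`), Kronecker character `κ`; `V`, `V′` globally minimal, good ORDINARY at `2` with the
same `a₂`, newforms `f`, `f′` (`a_n(f′) = κ(n)a_n(f)`), `2 ∤ N`; `L₂⁻(f,ω,−2) = 0` (`h0`); the member `W` and its
companion `W′` with newforms `g = f⊗χ₈`, `g′ = f′⊗χ₈`, `L(W,1) = 0`, `L′(W,1) ≠ 0`, `L(W′,1) ≠ 0`; the tower
`K ⊂ H = K(t)`, `t² = -2`, with `τ` (fixing `K`, `τt = −t`) in `G` of sign `−1` and `c ∈ Aut(K/ℚ)`, `cu = −u`,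
`u² = e`; `V^{(2)}(ℚ) = ℤP + torsion`, `V^{(2)(e)}(ℚ)` torsion; `DH` `G`-invariant with PIN `⟨P′,P′⟩_{DH} = h₂`;
Disegni's conjoined clauses `hGZ` at `a = ι(α)`, `χ_H = χ₈∘N`. Then
`ι⁻¹(L′(W,1)·L(W′,1)·Z°)·h₂ = −σ₀·log₂5·ι⁻¹(ĥ(P)·u·Ω⁺_f·Ω⁺_{f′})·L₂′(f,−2)·L₂(f′,−2)` for a sign `σ₀`.
[cite: Disegni2017, Theorem A, (1.1.3), Theorem B (arXiv v3 PDF pp. 4–8)] [cite: PerrinRiou1987, §1]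
[cite: MazurTateTeitelbaum1986Invent, §I.14 (14.3)] -/
theorem quotient_law_chi8' (h2 : Module.finrank ℚ K = 2)
    (hsplit : ((Ideal.span {(2 : ℤ)}).primesOver (𝓞 K)).ncard = 2)
    (𝔭 𝔭' : HeightOneSpectrum (𝓞 K)) (h𝔭 : ((2 : ℕ) : 𝓞 K) ∈ 𝔭.asIdeal)
    (h𝔭' : ((2 : ℕ) : 𝓞 K) ∈ 𝔭'.asIdeal)
    (κ : DirichletCharacter ℂ (NumberField.discr K).natAbs)
    (hκ : ∀ ℓ : ℕ, ℓ.Prime → ℓ ≠ 2 → κ ℓ = (jacobiSym (NumberField.discr K) ℓ : ℂ))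
    (hκ2 : κ 2 = if NumberField.discr K % 8 = 1 then 1
        else if NumberField.discr K % 8 = 5 then -1 else 0)
    (hd : Nat.Coprime 2 (NumberField.discr K).natAbs)
    -- the good pair
    (V V' : WeierstrassCurve ℚ) [V.IsElliptic] [V.IsGloballyMinimal] [V'.IsElliptic] [V'.IsGloballyMinimal]
    (hordV : IsOrdinaryAt V 2) (hordV' : IsOrdinaryAt V' 2) (hap : V'.frobeniusTrace 2 = V.frobeniusTrace 2)
    {N N' : ℕ} [NeZero N] [NeZero N'] {f : CuspForm (Gamma0 N) 2}
    {f' : CuspForm (Gamma0 N') 2} (hfV : IsNewformOf V f) (hfV' : IsNewformOf V' f')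
    (hV' : ∀ n : ℕ, cuspCoeff f' n = κ (n : ZMod _) * cuspCoeff f n)
    (h0 : HasSum (fun k : ℕ ↦ PowerSeries.coeff k (padicLFunctionMinusBranch f (unitRoot V 2 : ℚ_[2]) 1) *
      (-2 : ℚ_[2]) ^ k) 0)
    -- the member and its companion (archimedean side)
    (hmod : hasEntireLFunction_rat) {M M' : ℕ} [NeZero M] [NeZero M']
    {g : CuspForm (Gamma0 M) 2} {g' : CuspForm (Gamma0 M') 2}
    (W W' : WeierstrassCurve ℚ) [W.IsElliptic] [W'.IsElliptic]
    (hg : IsNewformOf W g) (hg' : IsNewformOf W' g')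
    (hgε : ∀ m : ℕ, cuspCoeff g m = (ZMod.χ₈'.ringHomComp (Int.castRingHom ℂ)) m * cuspCoeff f m)
    (hg'ε : ∀ m : ℕ, cuspCoeff g' m = (ZMod.χ₈'.ringHomComp (Int.castRingHom ℂ)) m * cuspCoeff f' m)
    (hW1 : W.entireLFunction 1 = 0) (hL : deriv W.entireLFunction 1 ≠ 0) (hL' : W'.entireLFunction 1 ≠ 0)
    -- the tower frame and the sign character
    {H : Type} [Field H] [NumberField H] [Algebra K H] (hKH : Module.finrank K H = 2) {t : H}
    (htK : t ∉ Set.range (algebraMap K H)) (ht2 : t ^ 2 = algebraMap ℚ H (-2))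
    (G : Subgroup (H ≃ₐ[ℚ] H)) (χ : G →* ℂˣ) (s : G → ℤ) (hs : ∀ σ, ((χ σ : ℂˣ) : ℂ) = (s σ : ℂ))
    (τ : H ≃ₐ[ℚ] H) (hτG : τ ∈ G) (hsτ : s ⟨τ, hτG⟩ = -1)
    (hτK : ∀ a : K, τ (algebraMap K H a) = algebraMap K H a) (hτt : τ t = -t)
    {u : K} {e : ℚ} (hu : u ∉ Set.range (algebraMap ℚ K)) (hue : u ^ 2 = algebraMap ℚ K e)
    (c : K ≃ₐ[ℚ] K) (hcu : c u = -u)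
    -- the member's Mordell–Weil data
    [(V.quadraticTwist (-2)).IsElliptic] {P : (V.quadraticTwist (-2)).toAffine.Point}
    (hgen : ∀ R : (V.quadraticTwist (-2)).toAffine.Point,
      ∃ (k : ℤ) (T : (V.quadraticTwist (-2)).toAffine.Point), IsOfFinAddOrder T ∧ R = k • P + T)
    (htors : ∀ Q : ((V.quadraticTwist (-2)).quadraticTwist e).toAffine.Point, IsOfFinAddOrder Q)
    -- Disegni's datum: invariance, PIN, and the conjoined clauses (PRINT stub of the road)
    (DH : PAdicHeightDataK V 2 H)
    (hDH : ∀ (σ : G) (a b : (V.baseChange H).toAffine.Point),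
      DH.pairing (pointGalHom V H σ.1 a) (pointGalHom V H σ.1 b) = DH.pairing a b)
    {h₂ : ℚ_[2]}
    (hpin : DH.pairing
      (twistPointEquivOver V (not_mem_range_rat_of_not_mem_range htK) ht2
        (QuadraticDescent.incl H (V.quadraticTwist (-2)) P))
      (twistPointEquivOver V (not_mem_range_rat_of_not_mem_range htK) ht2
        (QuadraticDescent.incl H (V.quadraticTwist (-2)) P)) = h₂)
    (hGZ : ChiLineGrossZagierClauses ι K V H f (ι (((unitRoot V 2 : ℚ_[2]) : PadicAlgCl 2)))
      (baseChangeDirichlet K (ZMod.χ₈'.ringHomComp (Int.castRingHom ℂ))) 𝔭 𝔭' G χ DH) :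
    ∃ σ₀ : ℤˣ,
      ((ι.symm ((deriv W.entireLFunction 1 * W'.entireLFunction 1) *
          zCirc (p := 2) (ι (((unitRoot V 2 : ℚ_[2]) : PadicAlgCl 2))) N
            (baseChangeDirichlet K (ZMod.χ₈'.ringHomComp (Int.castRingHom ℂ))) 𝔭 𝔭') : PadicAlgCl 2) : ℂ_[2]) *
        algebraMap ℚ_[2] ℂ_[2] h₂ =
      -((σ₀ : ℤ) : ℂ_[2]) * algebraMap ℚ_[2] ℂ_[2] (padicLog 2 (cyclotomicGenerator 2)) *
        ((ι.symm ((canonicalHeight P : ℂ) *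
            (-((splitLocalConstant 2 : ℂ) * (minusPeriod f : ℂ) * (minusPeriod f' : ℂ)))) : PadicAlgCl 2) : ℂ_[2]) *
        (algebraMap ℚ_[2] ℂ_[2] (∑' k : ℕ, PowerSeries.coeff k (padicLFunctionMinusBranch f (unitRoot V 2 : ℚ_[2]) 1) *
            (k : ℚ_[2]) * (-2) ^ (k - 1)) *
          algebraMap ℚ_[2] ℂ_[2] (∑' k : ℕ, PowerSeries.coeff k (padicLFunctionMinusBranch f' (unitRoot V 2 : ℚ_[2]) 1) *
            (-2) ^ k)) := by
  haveI : NeZero (2 ^ (2 + 1)) := ⟨by norm_num⟩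
  -- (1) the seam, with the PIN substituted
  have hseam : ∀ y₁ y₂ : (V.baseChange H).toAffine.Point, ∃ r : ℚ,
      chiHeightPairing V H G χ y₁ y₂ =
        (((r : ℝ) * (Module.finrank ℚ H : ℝ) * canonicalHeight P : ℝ) : ℂ) ∧
      chiPAdicPairing ι V H DH G χ y₁ y₂ = algebraMap ℚ_[2] ℂ_[2] ((r : ℚ_[2]) * h₂) := by
    intro y₁ y₂
    obtain ⟨r, hNT, hPA⟩ := exists_rat_chiPairings_eq_tower V G χ s hKH htK ht2 hs τ hτG hsτ hτK hτt h2 hu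
      hue c hcu hgen htors y₁ y₂
    exact ⟨r, hNT, by rw [hPA 2 ι DH hDH, hpin]⟩
  -- (2) the archimedean evaluation `Λ′ = L′(W,1)·L(W′,1)`
  have harch : ∀ (Car : ℝ) (y₁ y₂ : (V.baseChange H).toAffine.Point) (q : ℂ),
      ChiArchRatioClause K V H f (baseChangeDirichlet K (ZMod.χ₈'.ringHomComp (Int.castRingHom ℂ))) Car G χ
        y₁ y₂ q →
        ((Module.finrank ℚ H : ℂ))⁻¹ * chiHeightPairing V H G χ y₁ y₂ =
          q / 2 * (Car : ℂ) * (deriv W.entireLFunction 1 * W'.entireLFunction 1) :=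
    fun Car y₁ y₂ q hA =>
      chiArchRatioClause_apply_of_entireLFunction_one_eq_zero K hmod h2 κ hκ hκ2 hd hfV.1 hV' (n := 2 + 1)
        (ε := (ZMod.χ₈'.ringHomComp (Int.castRingHom ℂ) : DirichletCharacter ℂ (2 ^ (2 + 1))))
        isPrimitive_χ₈'_ringHomComp W W' hg hg' hgε hg'ε hW1 hA
  -- (3) the factorisation of the first coefficient
  have hfact : ∀ (Car : ℝ) (Gχ : PowerSeries ℂ_[2]),
      ChiLineInterpolation ι K f (ι (((unitRoot V 2 : ℚ_[2]) : PadicAlgCl 2)))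
        (baseChangeDirichlet K (ZMod.χ₈'.ringHomComp (Int.castRingHom ℂ))) 𝔭 𝔭' Car Gχ →
      PowerSeries.coeff 1 Gχ =
        -((ι.symm ((-((splitLocalConstant 2 : ℂ) * (minusPeriod f : ℂ) * (minusPeriod f' : ℂ))) * (Car : ℂ)) :
            PadicAlgCl 2) : ℂ_[2]) *
          (algebraMap ℚ_[2] ℂ_[2] (∑' k : ℕ, PowerSeries.coeff k (padicLFunctionMinusBranch f (unitRoot V 2 : ℚ_[2]) 1) *
              (k : ℚ_[2]) * (-2) ^ (k - 1)) *
            algebraMap ℚ_[2] ℂ_[2] (∑' k : ℕ, PowerSeries.coeff k (padicLFunctionMinusBranch f' (unitRoot V 2 : ℚ_[2]) 1) *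
              (-2) ^ k)) := by
    intro Car Gχ hInt
    rw [coeff_one_chi8'Line_eq_of_hasSum_zero ι K h2 hsplit 𝔭 𝔭' h𝔭 h𝔭' κ hκ hκ2 hd V V' hordV hordV'
      hap hfV hfV' hV' hInt h0,
      show -(splitLocalConstant 2 : ℂ) * (Car : ℂ) * (minusPeriod f : ℂ) * (minusPeriod f' : ℂ) =
        (-((splitLocalConstant 2 : ℂ) * (minusPeriod f : ℂ) * (minusPeriod f' : ℂ))) * (Car : ℂ) by ring]
    ring
  -- (4) `Z° ≠ 0` (the character is primitive, `a = ι(α) ≠ 0`)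
  have ha : ι (((unitRoot V 2 : ℚ_[2]) : PadicAlgCl 2)) ≠ 0 := by
    have hα : (unitRoot V 2 : ℚ_[2]) ≠ 0 := by
      rw [← norm_pos_iff, norm_unitRoot_holds V 2 hordV]; exact one_pos
    rw [map_ne_zero]
    exact (map_ne_zero_iff _ (algebraMap ℚ_[2] (PadicAlgCl 2)).injective).mpr hα
  have hZ := zCirc_baseChangeDirichlet_ne_zero (p := 2) K h2 hsplit (n := 2 + 1) (by norm_num)
    (θ := (ZMod.χ₈'.ringHomComp (Int.castRingHom ℂ) : DirichletCharacter ℂ (2 ^ (2 + 1))))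
    isPrimitive_χ₈'_ringHomComp ha N 𝔭 𝔭' h𝔭 h𝔭'
  exact quotient_law_of_clauses ι hGZ hseam (mul_ne_zero hL hL') harch hfact hZ


end Odd

end Summit.BirchSwinnertonDyer.BirchSwinnertonDyer.Theorems.PrintCf2.DisegniPairTwo

end
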